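import Literature.NumberTheory.Transcendental.RoySmallValueMultiplicity
import Literature.NumberTheory.Transcendental.RoySmallValueGainPhi
import Literature.NumberTheory.Transcendental.RoySmallValuePhiLength
import Literature.NumberTheory.Transcendental.RoySmallValueLinearFactorsFintype
import HarnessLib

/-!
# Roy's small value estimate for `𝔾ₐ × 𝔾ₘ` — Proposition 6.4 for an orbit

Topic `Literature/NumberTheory/Transcendental`. Part of the formalisation of the proof of Roy 2013,
Theorem 1.1 (named fact `roy2013_thm_1_1`, `RoySmallValueEstimates.lean`). Source: D. Roy,
*A small value estimate for `𝔾ₐ × 𝔾ₘ`*, Mathematika 59 (2013) 333–363 = arXiv:1301.0663, §6,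
Proposition 6.4 (p. 17 of the arXiv text):

> **Proposition 6.4.** [...] Then any irreducible component `Z` of `W` in `ℙ²_ℚ` has dimension `0`
> with `deg(Z) ≤ D²/T` and `h(Z) ≤ 3DY/T`.
> *Proof.* [...] `F(R) = a R(α₁)^{e₁} ⋯ R(α_t)^{e_t}` [...] `e₁ = ⋯ = e_s` [...] our claim reduces to
> showing that `e₁ ≥ T` [...] Since `G^T` divides `F`, we obtain `T deg(Z) = T deg(G) ≤ deg(F) = D²`
> [...] `T h_𝓑(Z) = T h_𝓑(G) ≤ h_𝓑(F) + 2D² log binom(D+2, 2)` [...]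

In this development `Z` is an orbit `O` (under `Aut(K/ℚ)`) of normalised representatives of
`𝒵(P, Q)` (`ZeroConfigK`), `F = Φ(P, Q, ·) = c ∏_j ℓ_{α_j}^{e_j}` with exact multiplicities
(`RoySmallValueFactorization`), and the two conclusions become (`prop_6_4_orbit`):

* `T · #O ≤ #M₂` (`= D²` for the data of `exists_phi_data`) — from `e_j ≥ T` for `j ∈ O`
  (`le_mult_of_mem_vanIdeal`, i.e. Prop. 3.6 (ii) + Theorem 5.2 for `Φ`) and `∑ e_j = #M₂`;
* `T · D · ∑_{j ∈ O} h_K(a_j) ≤ [K:ℚ] log 𝓛(F)` — from the Gelfond–Mahler inequality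
  `∑_j e_j h_K(ver a_j) ≤ [K:ℚ] log 𝓛(F₀)` of the tree (`sum_mul_logHeight_le'`, replacing the
  `[LR]` estimate `T h_𝓑(G) ≤ h_𝓑(F) + …`) and `h_K(ver a) = D h_K(a)` (`logHeight_veronese`,
  replacing Lemma 2.1), with `𝓛(F) ≤ N! ‖P‖^{N₀} ‖Q‖^{N₁}` available from `l1Norm_royF_le`.

The points of `O` are assumed to lie in `𝒢 = {x₀x₂ ≠ 0}` (Roy: Lemma 6.3; the two exceptional
points are rational and treated apart) and `P, Q ∈ I^{(α_j, T)}` for `j ∈ O`. Everything is proved;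
no definitions, no named facts.

## References

* [Roy2013] D. Roy, *A small value estimate for 𝔾ₐ × 𝔾ₘ*, Mathematika 59 (2013), 333–363
  (arXiv:1301.0663), Proposition 6.4 and its proof.
-/

noncomputable section

open MvPolynomial Finset NumberField Height

namespace Literature.NumberTheory.Transcendental

namespace Roy2013

open Nesterenko

variable {D : ℕ} {M₁ M₂ : Finset (Fin 3 →₀ ℕ)}

/-- **Roy 2013, Proposition 6.4, for an orbit.** See the module docstring.
[cite: Roy2013, Proposition 6.4] -/
theorem prop_6_4_orbit {P Q : CX} (hP : P.IsHomogeneous D) (hQ : Q.IsHomogeneous D)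
    (hM₁ : ∀ μ ∈ M₁, μ.degree = 2 * D) (hM₂ : ∀ μ ∈ M₂, μ.degree = 2 * D)
    (σ : PhiCol D M₁ M₂ ≃ PhiRow D)
    {K : IntermediateField ℚ ℂ} [Normal ℚ K] [NumberField K] {m : ℕ} (Z : ZeroConfigK K (Fin m))
    {F₀ : MvPolynomial (CoefIdx D) ℤ} (hF₀ : map (Int.castRingHom ℂ) F₀ = royF D M₁ M₂ σ P Q)
    {c : ℂ} (hc : c ≠ 0) {e : Fin m → ℕ}
    (hFeq : royF D M₁ M₂ σ P Q = C c * ∏ i, evalForm D (Z.α i) ^ e i)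
    (hesum : ∑ i, e i = M₂.card)
    {L T : ℕ} (hT₁ : (L + 1).choose 2 < T) (hT₂ : T ≤ (L + 2).choose 2) (hLD : L < D)
    (i₀ : Fin m)
    (hO : ∀ j ∈ Z.orb i₀, Z.α j 0 ≠ 0 ∧ Z.α j 2 ≠ 0 ∧
      P ∈ vanIdeal (Z.α j 1 / Z.α j 0) (Z.α j 2 / Z.α j 0) T ∧
      Q ∈ vanIdeal (Z.α j 1 / Z.α j 0) (Z.α j 2 / Z.α j 0) T) :
    T * (Z.orb i₀).card ≤ M₂.card ∧
      (T : ℝ) * D * ∑ j ∈ Z.orb i₀, logHeight (Z.rep j) ≤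
        Module.finrank ℚ K * Real.log (l1Norm (royF D M₁ M₂ σ P Q)) := by
  classical
  -- `e_j ≥ T` on the orbit
  have hT : ∀ j ∈ Z.orb i₀, T ≤ e j := fun j hj => by
    obtain ⟨h0, h2, hPv, hQv⟩ := hO j hj
    exact le_mult_of_mem_vanIdeal hP hQ hM₁ hM₂ σ Z.α_ne_zero Z.sep hc hFeq hT₁ hT₂ hLD h0 h2
      hPv hQv
  refine ⟨?_, ?_⟩
  · -- degrees
    calc T * (Z.orb i₀).card = ∑ _j ∈ Z.orb i₀, T := by rw [sum_const, smul_eq_mul, mul_comm]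
      _ ≤ ∑ j ∈ Z.orb i₀, e j := sum_le_sum hT
      _ ≤ ∑ j, e j := sum_le_sum_of_subset_of_nonneg (subset_univ _) fun _ _ _ => Nat.zero_le _
      _ = M₂.card := hesum
  · -- heights
    have hfac : map (Int.castRingHom ℂ) F₀ = C c * ∏ i, evalForm D (Z.α i) ^ e i := by
      rw [hF₀, hFeq]
    have hF₀0 : F₀ ≠ 0 := by
      intro h
      have h1 : royF D M₁ M₂ σ P Q = 0 := by rw [← hF₀, h, map_zero]
      rw [hFeq] at h1
      exact (mul_ne_zero (C_ne_zero.mpr hc) (prod_ne_zero_iff.mpr fun i _ =>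
        pow_ne_zero _ (evalForm_ne_zero (Z.α_ne_zero i)))) h1
    obtain ⟨A, -, hK⟩ := exists_factorisation_fld Z hfac
    set cv : Fin m → CoefIdx D → K := fun j ν => ∏ k, Z.rep j k ^ (ν.1 k) with hcv
    have hK' : map (Int.castRingHom K) F₀ = C A * ∏ j, (∑ ν, C (cv j ν) * X ν) ^ e j := by
      rw [hK]; rfl
    have hcv0 : ∀ j, cv j ≠ 0 := fun j => veronese_rep_ne_zero Z j
    haveI : Nonempty (CoefIdx D) := ⟨⟨Finsupp.single 0 D, by
      rw [mem_finsuppAntidiag]; exact ⟨by simp, subset_univ _⟩⟩⟩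
    have h := sum_mul_logHeight_le' hF₀0 hcv0 hK'
    -- the left-hand side
    have hL : ∑ j, (e j : ℝ) * logHeight (cv j) = (D : ℝ) * ∑ j, (e j : ℝ) * logHeight (Z.rep j) := by
      rw [Finset.mul_sum]
      refine Finset.sum_congr rfl fun j _ => ?_
      rw [hcv, logHeight_veronese (Z.rep j) (Z.rep_ne_zero j)]
      ring
    have hlow : (T : ℝ) * D * ∑ j ∈ Z.orb i₀, logHeight (Z.rep j) ≤
        (D : ℝ) * ∑ j, (e j : ℝ) * logHeight (Z.rep j) := by
      rw [mul_comm (T : ℝ) D, mul_assoc, Finset.mul_sum, Finset.mul_sum, Finset.mul_sum]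
      calc ∑ j ∈ Z.orb i₀, (D : ℝ) * ((T : ℝ) * logHeight (Z.rep j))
          ≤ ∑ j ∈ Z.orb i₀, (D : ℝ) * ((e j : ℝ) * logHeight (Z.rep j)) :=
            sum_le_sum fun j hj => mul_le_mul_of_nonneg_left
              (mul_le_mul_of_nonneg_right (by exact_mod_cast hT j hj) (logHeight_nonneg _))
              (Nat.cast_nonneg _)
        _ ≤ ∑ j, (D : ℝ) * ((e j : ℝ) * logHeight (Z.rep j)) :=
            sum_le_sum_of_subset_of_nonneg (subset_univ _) fun j _ _ =>
              mul_nonneg (Nat.cast_nonneg _) (mul_nonneg (Nat.cast_nonneg _) (logHeight_nonneg _))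
    -- the right-hand side
    have hR : Real.log (∑ mo ∈ F₀.support, |((coeff mo F₀ : ℤ) : ℝ)|) =
        Real.log (l1Norm (royF D M₁ M₂ σ P Q)) := by
      rw [← l1Norm_map_intCast, hF₀]
    rw [hL, hR] at h
    exact hlow.trans h

end Roy2013

end Literature.NumberTheory.Transcendental
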